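import Summits.FinalStateConjecture.FinalStateConjecture.Theorems.SwallowTheDatumUniversalWitnessFamilyRegionOneAnalysis
import Summits.FinalStateConjecture.FinalStateConjecture.Theorems.EIHFluxBalanceInertialRecessionSchwarzschildFrame
import Literature.Geometry.Lorentzian.KerrData
import Literature.Geometry.Lorentzian.KerrDataProofs
import Literature.Geometry.Lorentzian.KerrSchildCoord
import Literature.Geometry.Lorentzian.OpensCausality
import Literature.Geometry.Lorentzian.CausalityPushUp
import Literature.Geometry.Lorentzian.CausalityConditionsProofs

/-!
# Crux `SwallowTheDatum.UniversalWitnessFamily` (stmt-FinalStateConjecture-10051), line `Sketch`,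
# stub `stub_regionOneDecomposition` — part 2: causal primitives of the Schwarzschild exterior

In the Kerr–Schild Schwarzschild exterior `(Kerr.region 0 (2M), g_{M,0}, V = −g♯dt*)`:

* `kerr_bilin_zero_spin_self` — `g(v, v) = −(v⁰)² + ‖ṽ‖² + (2M/r)(v⁰ + ⟪x̃, ṽ⟫/r)²`;
* the vertical lines `s ↦ x + s e₀` (orbits of the Killing field `∂_{t*}`) are future timelike
  curves (`isFutureTimelikeCurveOn_vert`), whence `x + s e₀ ∈ I⁺(x)` for `s > 0`, `∈ J⁺(x)` for
  `s ≥ 0`, and the time-dual statements (`mem_chronologicalFuture_vert`, `mem_causalFuture_vert`,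
  `mem_chronologicalPast_vert`, `mem_causalPast_vert`);
* the time orientation `ksTime` (= that of `Kerr.spacetime M 0 (2M)` by `rfl`).

References: O'Neill 1983, Ch. 5 (timecones), Ch. 13 (Schwarzschild), Ch. 14, pp. 402–403;
Wald 1984, §6.4; Dafermos–Rodnianski arXiv:0811.0354, §5.1.
-/

set_option linter.dupNamespace false

noncomputable section

open scoped Manifold ContDiff Topology RealInnerProductSpace
open Set Function Filter Literature.Geometry.Lorentzian
open Summit.FinalStateConjecture.FinalStateConjecture.Theorems
  (nullCovector_zero_spin_apply scalarH_zero_spin kerr_bilin_apply_eq)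

namespace Summit.FinalStateConjecture.FinalStateConjecture.Theorems.SwallowTheDatum.UniversalWitnessFamily

/-! ## Membership and the Kerr–Schild form for `a = 0` -/

section Form

variable {M : ℝ}



/-- `η(v, v) = −(v⁰)² + ‖ṽ‖²`. -/
theorem minkowski_self_eq (v : E4) :
    Minkowski.bilin v v = -(v 0) ^ 2 + ‖E4.spatial v‖ ^ 2 := by
  rw [Minkowski.bilin_apply, ← real_inner_self_eq_norm_sq]
  rw [show inner ℝ (E4.spatial v) (E4.spatial v) = ∑ i : Fin 3, inner ℝ (E4.spatial v i)
    (E4.spatial v i) from PiLp.inner_apply _ _]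
  simp only [E4.spatial_apply, RCLike.inner_apply, conj_trivial]
  ring

/-- **The Schwarzschild Kerr–Schild form on the diagonal**: for `‖x̃‖ ≠ 0`,
`g_{M,0}(x)(v, v) = −(v⁰)² + ‖ṽ‖² + (2M/r)(v⁰ + ⟪x̃, ṽ⟫/r)²`, `r = ‖x̃‖`. -/
theorem kerr_bilin_zero_spin_self {x : E4} (hx : E4.spatialNorm x ≠ 0) (v : E4) :
    Kerr.bilin M 0 x v v = -(v 0) ^ 2 + ‖E4.spatial v‖ ^ 2 +
      2 * M / E4.spatialNorm x * (v 0 + ⟪E4.spatial x, E4.spatial v⟫ / E4.spatialNorm x) ^ 2 := by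
  rw [kerr_bilin_apply_eq, nullCovector_zero_spin_apply hx, scalarH_zero_spin hx, minkowski_self_eq]
  ring

/-- `g_{M,0}(x)(e₀, e₀) = −1 + 2M/r`. -/
theorem kerr_bilin_basisVector_zero_self {x : E4} (hx : E4.spatialNorm x ≠ 0) :
    Kerr.bilin M 0 x (E4.basisVector 0) (E4.basisVector 0) = -1 + 2 * M / E4.spatialNorm x := by
  have h0 : E4.spatial (E4.basisVector 0) = 0 := by
    ext i; rw [E4.spatial_apply]; simp
  rw [kerr_bilin_zero_spin_self hx, h0]
  simp

end Form

/-! ## The vertical curves `s ↦ x + s e₀` are future timelike -/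

section Vertical

variable {M : ℝ}


/-- The vertical curve starts at the point. -/
@[simp] theorem vert_zero (x : Kerr.region 0 (Kerr.rPlus M 0)) : vert x 0 = x := by
  ext1; simp [vert_coe]

/-- Vertical translates compose additively. -/
theorem vert_add (x : Kerr.region 0 (Kerr.rPlus M 0)) (s s' : ℝ) :
    vert (vert x s) s' = vert x (s + s') := by
  ext1; simp only [vert_coe]; rw [add_smul, add_assoc]

/-- Vertical translation preserves the spatial radius. -/
theorem spatialNorm_vert (x : Kerr.region 0 (Kerr.rPlus M 0)) (s : ℝ) :
    E4.spatialNorm (vert x s).1 = E4.spatialNorm x.1 := by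
  rw [vert_coe]
  unfold E4.spatialNorm
  congr 1
  ext i
  simp [E4.spatial_apply]

/-- Vertical translation shifts the Kerr–Schild time by `s`. -/
theorem vert_apply_zero (x : Kerr.region 0 (Kerr.rPlus M 0)) (s : ℝ) : (vert x s).1 0 = x.1 0 + s := by
  rw [vert_coe]; simp

/-- Vertical translation shifts static time by `s`. -/
theorem staticTime_vert (x : Kerr.region 0 (Kerr.rPlus M 0)) (s : ℝ) :
    staticTime M (vert x s).1 = staticTime M x.1 + s := by
  rw [vert_coe, staticTime_add_smul_basisVector]

variable [Kerr.Facts]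


omit [Kerr.Facts] in
/-- The vertical curve is differentiable with velocity `e₀` (as a curve in the open submanifold). -/
theorem mdifferentiableAt_vert (x : Kerr.region 0 (Kerr.rPlus M 0)) (s : ℝ) :
    MDifferentiableAt 𝓘(ℝ, ℝ) 𝓘(ℝ, E4) (vert x) s ∧ (velocity 𝓘(ℝ, E4) (vert x) s : E4) = E4.basisVector 0 := by
  have hd : HasDerivAt (fun s : ℝ ↦ x.1 + s • E4.basisVector 0) (E4.basisVector 0) s := by
    simpa using ((hasDerivAt_id s).smul_const (E4.basisVector 0)).const_add x.1
  have hval : (Subtype.val ∘ vert x) = fun s : ℝ ↦ x.1 + s • E4.basisVector 0 := rfl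
  have hmd : MDifferentiableAt 𝓘(ℝ, ℝ) 𝓘(ℝ, E4) (Subtype.val ∘ vert x) s := by
    rw [hval]
    exact hd.differentiableAt.mdifferentiableAt
  refine ⟨(mdifferentiableAt_subtypeVal_comp_curve_iff _).1 hmd, ?_⟩
  rw [← velocity_subtypeVal_comp (I := 𝓘(ℝ, E4)) (Kerr.region 0 (Kerr.rPlus M 0)) (vert x) s]
  change mfderiv 𝓘(ℝ, ℝ) 𝓘(ℝ, E4) (Subtype.val ∘ vert x) s (1 : ℝ) = E4.basisVector 0
  rw [hval, mfderiv_eq_fderiv, hd.hasFDerivAt.fderiv]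
  exact one_smul ℝ _

/-- **The vertical curves are future timelike** for `M > 0` (`g(e₀, e₀) = −1 + 2M/r < 0` on
`{r > 2M}`, `g(V, e₀) = −1 < 0`). -/
theorem isFutureTimelikeCurveOn_vert (hM : 0 < M) (x : Kerr.region 0 (Kerr.rPlus M 0)) (S : Set ℝ) :
    (Kerr.smoothMetric M 0 (Kerr.rPlus M 0)).IsFutureTimelikeCurveOn
      (ksTime hM.le) (vert x) S := by
  intro s _
  obtain ⟨hd, hv⟩ := mdifferentiableAt_vert x s
  have hr : 2 * M < E4.spatialNorm (vert x s).1 := by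
    rw [spatialNorm_vert]; exact two_mul_lt_spatialNorm hM.le x
  have hr0 : E4.spatialNorm (vert x s).1 ≠ 0 := by linarith
  have hrad : 0 < Kerr.radius 0 (vert x s).1 := radius_pos hM.le _
  have htl : (Kerr.smoothMetric M 0 (Kerr.rPlus M 0)).val (vert x s) (velocity 𝓘(ℝ, E4) (vert x) s)
      (velocity 𝓘(ℝ, E4) (vert x) s) < 0 := by
    rw [show (velocity 𝓘(ℝ, E4) (vert x) s) = (E4.basisVector 0 : E4) from hv]
    show Kerr.bilin M 0 (vert x s).1 (E4.basisVector 0) (E4.basisVector 0) < 0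
    rw [kerr_bilin_basisVector_zero_self hr0]
    have : 2 * M / E4.spatialNorm (vert x s).1 < 1 := by
      rw [div_lt_one (by linarith)]; exact hr
    linarith
  have hne : (E4.basisVector 0 : E4) ≠ 0 := by
    intro h
    have h1 : (E4.basisVector 0 : E4) 0 = (0 : E4) 0 := by rw [h]
    rw [PiLp.zero_apply] at h1
    simp at h1
  refine ⟨hd, htl, ⟨htl.le, ?_⟩, ?_⟩
  · rw [show (velocity 𝓘(ℝ, E4) (vert x) s) = (E4.basisVector 0 : E4) from hv]
    exact hne
  · rw [show (velocity 𝓘(ℝ, E4) (vert x) s) = (E4.basisVector 0 : E4) from hv]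
    show Kerr.bilin M 0 (vert x s).1 (Kerr.timeVector M 0 (vert x s).1) (E4.basisVector 0) < 0
    rw [Kerr.bilin_timeVector hrad]
    simp

/-- `x + s e₀ ∈ I⁺(x)` for `s > 0`. -/
theorem mem_chronologicalFuture_vert (hM : 0 < M) (x : Kerr.region 0 (Kerr.rPlus M 0)) {s : ℝ}
    (hs : 0 < s) :
    vert x s ∈ (Kerr.smoothMetric M 0 (Kerr.rPlus M 0)).chronologicalFuture (ksTime hM.le) {x} :=
  ⟨x, rfl, vert x, 0, s, hs, isFutureTimelikeCurveOn_vert hM x _, vert_zero x, rfl⟩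

/-- `x + s e₀ ∈ J⁺(x)` for `s ≥ 0`. -/
theorem mem_causalFuture_vert (hM : 0 < M) (x : Kerr.region 0 (Kerr.rPlus M 0)) {s : ℝ}
    (hs : 0 ≤ s) :
    vert x s ∈ (Kerr.smoothMetric M 0 (Kerr.rPlus M 0)).causalFuture (ksTime hM.le) {x} := by
  rcases hs.eq_or_lt with h | h
  · subst h
    rw [vert_zero]
    exact LorentzianMetric.subset_causalFuture _ _ _ rfl
  · exact LorentzianMetric.chronologicalFuture_subset_causalFuture _ _ _
      (mem_chronologicalFuture_vert hM x h)

/-- `x ∈ I⁻(x + s e₀)` for `s > 0`. -/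
theorem mem_chronologicalPast_vert (hM : 0 < M) (x : Kerr.region 0 (Kerr.rPlus M 0)) {s : ℝ}
    (hs : 0 < s) :
    x ∈ (Kerr.smoothMetric M 0 (Kerr.rPlus M 0)).chronologicalPast (ksTime hM.le) {vert x s} :=
  LorentzianMetric.mem_chronologicalPast_of_mem_chronologicalFuture (mem_chronologicalFuture_vert hM x hs)

/-- `x ∈ J⁻(x + s e₀)` for `s ≥ 0`. -/
theorem mem_causalPast_vert (hM : 0 < M) (x : Kerr.region 0 (Kerr.rPlus M 0)) {s : ℝ}
    (hs : 0 ≤ s) :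
    x ∈ (Kerr.smoothMetric M 0 (Kerr.rPlus M 0)).causalPast (ksTime hM.le) {vert x s} := by
  rcases hs.eq_or_lt with h | h
  · subst h
    rw [vert_zero]
    exact LorentzianMetric.subset_causalPast _ _ _ rfl
  · -- the reversed vertical curve is future causal for the reversed orientation
    refine Or.inr ⟨vert x s, rfl, fun u ↦ vert x (0 + s - u), 0, s, h, ?_, by simp, by simp⟩
    exact ((isFutureTimelikeCurveOn_vert hM x (Icc 0 s)).isFutureCausalCurveOn).reverseParam

end Vertical

/-- **Anchor of part 3** (registered sub-goal of `stub_regionOneDecomposition`): every point lies in the causal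
past of its future translates along the static Killing field `∂_{t*}`. -/
theorem regionOneCausal_anchor : ∀ [Kerr.Facts] (M : ℝ) (hM : 0 < M) (x : Kerr.region 0 (Kerr.rPlus M 0)) (s : ℝ), 0 ≤ s → x ∈ (Kerr.smoothMetric M 0 (Kerr.rPlus M 0)).causalPast ((Kerr.timeOrientation M 0 (Kerr.rPlus M 0) hM.le).ofLE le_top) {vert x s} := by
  intro _ M hM x s hs
  exact mem_causalPast_vert hM x hs

end Summit.FinalStateConjecture.FinalStateConjecture.Theorems.SwallowTheDatum.UniversalWitnessFamily

end
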